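import Summits.QuantumFields.BalabanUV.Beta.FP.InducedPolarizationLoops
import Summits.QuantumFields.BalabanUV.Beta.D1BFx.SliceTransferModel

/-!
# `BalabanUV.Beta.FP.InducedPolarizationCurve` — road «FP» for binder row D1, row **RHOA-2 (C-sector, CURVE form)** of `RHOA-DESIGN.md` v1.1:
# the displayed jets `C₁`, `C₂` of `InducedPolarizationLoops` ARE the first and second `u`-derivatives of the induced coarse form
# `u ↦ C(u) = Q(u)·H(u)⁻¹·Q(u)ᵀ` along `C²` matrix curves, so that `½·secondVar C C₁ C₂` IS `½·δ² log|det C|` — the loop catalogue of the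
# induced polarization read «along a C² matrix path» as the row asks

HONEST DEPENDENCY (cell records, verbatim): «continuum YM on T⁴ ⇐ BetaPertH ∧ nine spine estimates (0/9 proved); BetaPertH ⇐ (D1) ∧ (D4) ∧
CAP+tail; G-an2-4 gates asym, D1 and NE2/3/4.»  HONEST FRAMING (cell contract, verbatim): «discharging `BetaPertH` makes Bałaban's UV stability
UNCONDITIONAL — a real constructive-QFT result; it is NOT the continuum limit and NOT the Clay problem.»  THIS MODULE is [folklore] one-variable
calculus of matrix curves (Mathlib `HasDerivAt`, the cell's `D1BFx.SliceTransferModel.hasDerivAt_matMul`∕`hasDerivAt_transpose` and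
`D1BFx.LogDetSecondVariation.hasDerivAt_inv_entry`∕`hasDerivAt_logAbsDet`∕`hasDerivAt_trace_inv_mul` BY NAME) over ABSTRACT curves `H(u)`, `Q(u)`;
NO estimate, NO lattice object, nothing of Bałaban's manuscripts, no definition, no `def … : Prop`, nothing cited, 0 sorry.  NOT D1, NOT BetaPertH,
NOT continuum, NOT Clay.

ABSOLUTE RULE (cell charter, verbatim): «No internally-minted statement may enter as a cited fact. Every hypothesis is either kernel-proved in this
package or a verbatim quotation of a PUBLISHED theorem with page reference. The manuscript(s) under audit are NOT citable for their own disputed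
steps — they are the thing under adjudication; programme-internal (2001/route/tribunal) claims are never citable.»

CONTENT (all [folklore]; curves are `ℝ → ι → κ → ℝ` read through `Matrix.of`, the convention of `LogDetSecondVariation`∕`SliceTransferModel`).
* §1 `hasDerivAt_inv_matrix` — the inverse of a matrix curve: `(H⁻¹)′ = −H⁻¹·H₁·H⁻¹` as a MATRIX curve (`hasDerivAt_inv_entry` assembled).
* §2 **`hasDerivAt_blockProp`** — `(Q·H⁻¹·Qᵀ)′ = Q₁·(H⁻¹Qᵀ) + (QH⁻¹)·Q₁ᵀ − (QH⁻¹)·H₁·(H⁻¹Qᵀ)` = the displayed `C₁` of `InducedPolarizationLoops`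
  (no symmetry needed: `QP` is literally the left factor).
* §3 **`hasDerivAt_blockProp_jet₁`** — the first-jet curve `u ↦ Q₁(u)·H(u)⁻¹·Q(u)ᵀ + Q(u)·H(u)⁻¹·Q₁(u)ᵀ − Q(u)·H(u)⁻¹·H₁(u)·H(u)⁻¹·Q(u)ᵀ` has derivative
  the displayed `C₂` at `t` (`Q₂`, `H₂` the derivatives of `Q₁`, `H₁` at `t`).
* §4 **`hasDerivAt_logAbsDet_blockProp`** (`(log|det C|)′ = tr(C⁻¹·C₁)` near `t`) and **`secondVariation_blockProp`**: the derivative at `t` of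
  `u ↦ tr(C(u)⁻¹·C₁(u))` IS `secondVar C C₁ C₂`, hence (with `InducedPolarizationLoops.secondVar_blockProp_jets`, symmetric `H(t)`, `H₁(t)`) the
  Bałaban-object expression `2tr(Q̈𝓘) − 2tr(Q̇𝓘Q̇𝓘) + 2tr(GQ̇Γ₀Q̇ᵀ) − 4tr(Q̇Γ₀Ḣ𝓘) + 2tr(R^QḢPḢ) − tr(R^QḢR^QḢ) − tr(R^QḦ)`
  (**`secondVariation_blockProp_eq_loops`**).
NOT HERE: the L-sector (iii) (row RHOA-6d), tadpole-freeness (S4), any estimate.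
Provenance: D1 formalisation swarm leaf seat `b2b-balaban-beta-d1-formalise-leaf-05` gen 11 (road «FP» row RHOA-2, sequel announced in the CLAIM
journal 2026-08-20T23:49Z), 2026-08-21.
-/

noncomputable section

namespace Summit.QuantumFields.BalabanUV.Beta.FP.InducedPolarizationCurve

open Matrix Filter Topology
open Literature.MathematicalPhysics.QuantumFieldTheory.Balaban1983to89.Beta.Composition (blockProp)
open Literature.MathematicalPhysics.QuantumFieldTheory.Balaban1983to89.Beta.Envelope (minMap constrProp blockProp_eq)
open Summit.QuantumFields.BalabanUV.Beta.D1BFx.LogDetSecondVariation (secondVar hasDerivAt_inv_entry hasDerivAt_logAbsDet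
  hasDerivAt_trace_inv_mul)
open Summit.QuantumFields.BalabanUV.Beta.D1BFx.SliceTransferModel (hasDerivAt_entry hasDerivAt_matMul hasDerivAt_transpose hasDerivAt_matAdd)
open Summit.QuantumFields.BalabanUV.Beta.FP.InducedPolarizationLoops (secondVar_blockProp_jets)

variable {ν μ : Type*} [Fintype ν] [Fintype μ] [DecidableEq ν] [DecidableEq μ]

/-! ## §1 The inverse of a matrix curve -/

omit [Fintype μ] [DecidableEq μ] in
/-- [folklore] **`(H⁻¹)′ = −H⁻¹·H₁·H⁻¹`** as a matrix curve (entrywise `LogDetSecondVariation.hasDerivAt_inv_entry`). -/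
theorem hasDerivAt_inv_matrix {H : ℝ → ν → ν → ℝ} {H₁ : Matrix ν ν ℝ} {t : ℝ}
    (hH : HasDerivAt H (Matrix.of.symm H₁) t) (hdet : (Matrix.of (H t)).det ≠ 0) :
    HasDerivAt (fun u => Matrix.of.symm (Matrix.of (H u))⁻¹)
      (Matrix.of.symm (-((Matrix.of (H t))⁻¹ * H₁ * (Matrix.of (H t))⁻¹))) t := by
  refine hasDerivAt_pi.2 fun k => hasDerivAt_pi.2 fun l => ?_
  simp only [Matrix.of_symm_apply]
  exact hasDerivAt_inv_entry hH hdet k l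

/-! ## §2 The first jet of the induced coarse form -/

omit [DecidableEq μ] in
/-- [folklore] **THE FIRST JET OF `C = Q·H⁻¹·Qᵀ`**: along curves `H`, `Q` differentiable at `t` with `det H(t) ≠ 0`,
`(Q·H⁻¹·Qᵀ)′(t) = Q₁·(H⁻¹Qᵀ) + (QH⁻¹)·Q₁ᵀ − (QH⁻¹)·H₁·(H⁻¹Qᵀ)` — the displayed `C₁` of `InducedPolarizationLoops` (with `P = H(t)⁻¹`, `Q = Q(t)`). -/
theorem hasDerivAt_blockProp {H : ℝ → ν → ν → ℝ} {Q : ℝ → μ → ν → ℝ} {H₁ : Matrix ν ν ℝ} {Q₁ : Matrix μ ν ℝ} {t : ℝ}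
    (hH : HasDerivAt H (Matrix.of.symm H₁) t) (hQ : HasDerivAt Q (Matrix.of.symm Q₁) t) (hdet : (Matrix.of (H t)).det ≠ 0) :
    HasDerivAt (fun u => Matrix.of.symm (blockProp (Matrix.of (H u)) (Matrix.of (Q u))))
      (Matrix.of.symm (Q₁ * ((Matrix.of (H t))⁻¹ * (Matrix.of (Q t))ᵀ) + (Matrix.of (Q t) * (Matrix.of (H t))⁻¹) * Q₁ᵀ
        - (Matrix.of (Q t) * (Matrix.of (H t))⁻¹) * H₁ * ((Matrix.of (H t))⁻¹ * (Matrix.of (Q t))ᵀ))) t := by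
  -- `u ↦ Q(u)·H(u)⁻¹`
  have h1 := hasDerivAt_matMul (X := Q) (Y := fun u => Matrix.of.symm (Matrix.of (H u))⁻¹) hQ (hasDerivAt_inv_matrix hH hdet)
  -- `u ↦ (Q(u)·H(u)⁻¹)·Q(u)ᵀ`
  have h2 := hasDerivAt_matMul (X := fun u => Matrix.of.symm (Matrix.of (Q u) * Matrix.of (Matrix.of.symm (Matrix.of (H u))⁻¹)))
    (Y := fun u => Matrix.of.symm (Matrix.of (Q u))ᵀ) h1 (hasDerivAt_transpose hQ)
  have heq : (fun u => Matrix.of.symm (blockProp (Matrix.of (H u)) (Matrix.of (Q u))))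
      = fun u => Matrix.of.symm (Matrix.of (Matrix.of.symm (Matrix.of (Q u) * Matrix.of (Matrix.of.symm (Matrix.of (H u))⁻¹)))
          * Matrix.of (Matrix.of.symm (Matrix.of (Q u))ᵀ)) := by
    funext u; simp only [blockProp_eq, Equiv.apply_symm_apply]
  rw [heq]
  convert h2 using 2
  simp only [Equiv.apply_symm_apply, Matrix.add_mul, Matrix.mul_neg, Matrix.neg_mul, Matrix.mul_assoc]
  abel

/-! ## §3 The second jet -/

omit [DecidableEq μ] in
/-- [folklore] **THE SECOND JET OF `C`**: if `H`, `Q` have derivative curves `H₁(u)`, `Q₁(u)` at `t`, these have derivatives `H₂`, `Q₂` at `t`, and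
`det H(t) ≠ 0`, then the FIRST-JET CURVE `u ↦ Q₁(u)·H(u)⁻¹·Q(u)ᵀ + Q(u)·H(u)⁻¹·Q₁(u)ᵀ − Q(u)·H(u)⁻¹·H₁(u)·H(u)⁻¹·Q(u)ᵀ` has derivative at `t` the
displayed `C₂` of `InducedPolarizationLoops`:
`Q₂A + (QP)Q₂ᵀ − 2•(Q₁PH₁A) − 2•((QP)H₁PQ₁ᵀ) + 2•(Q₁PQ₁ᵀ) + 2•((QP)H₁PH₁A) − (QP)H₂A` (`P = H(t)⁻¹`, `A = P·Q(t)ᵀ`, all at `t`). -/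
theorem hasDerivAt_blockProp_jet₁ {H H₁ : ℝ → ν → ν → ℝ} {Q Q₁ : ℝ → μ → ν → ℝ} {H₂ : Matrix ν ν ℝ} {Q₂ : Matrix μ ν ℝ} {t : ℝ}
    (hH : HasDerivAt H (H₁ t) t) (hQ : HasDerivAt Q (Q₁ t) t)
    (hH₁ : HasDerivAt H₁ (Matrix.of.symm H₂) t) (hQ₁ : HasDerivAt Q₁ (Matrix.of.symm Q₂) t) (hdet : (Matrix.of (H t)).det ≠ 0) :
    HasDerivAt (fun u => Matrix.of.symm (Matrix.of (Q₁ u) * (Matrix.of (H u))⁻¹ * (Matrix.of (Q u))ᵀ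
        + Matrix.of (Q u) * (Matrix.of (H u))⁻¹ * (Matrix.of (Q₁ u))ᵀ
        - Matrix.of (Q u) * (Matrix.of (H u))⁻¹ * Matrix.of (H₁ u) * (Matrix.of (H u))⁻¹ * (Matrix.of (Q u))ᵀ))
      (Matrix.of.symm (Q₂ * ((Matrix.of (H t))⁻¹ * (Matrix.of (Q t))ᵀ)
        + (Matrix.of (Q t) * (Matrix.of (H t))⁻¹) * Q₂ᵀ
        - (2 : ℝ) • (Matrix.of (Q₁ t) * (Matrix.of (H t))⁻¹ * Matrix.of (H₁ t) * ((Matrix.of (H t))⁻¹ * (Matrix.of (Q t))ᵀ))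
        - (2 : ℝ) • ((Matrix.of (Q t) * (Matrix.of (H t))⁻¹) * Matrix.of (H₁ t) * (Matrix.of (H t))⁻¹ * (Matrix.of (Q₁ t))ᵀ)
        + (2 : ℝ) • (Matrix.of (Q₁ t) * (Matrix.of (H t))⁻¹ * (Matrix.of (Q₁ t))ᵀ)
        + (2 : ℝ) • ((Matrix.of (Q t) * (Matrix.of (H t))⁻¹) * Matrix.of (H₁ t) * (Matrix.of (H t))⁻¹ * Matrix.of (H₁ t)
            * ((Matrix.of (H t))⁻¹ * (Matrix.of (Q t))ᵀ))
        - (Matrix.of (Q t) * (Matrix.of (H t))⁻¹) * H₂ * ((Matrix.of (H t))⁻¹ * (Matrix.of (Q t))ᵀ))) t := by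
  -- the basic curves, read as matrices
  have hH' : HasDerivAt H (Matrix.of.symm (Matrix.of (H₁ t))) t := hH
  have hQ' : HasDerivAt Q (Matrix.of.symm (Matrix.of (Q₁ t))) t := hQ
  have hP := hasDerivAt_inv_matrix hH' hdet
  have hQT := hasDerivAt_transpose hQ'
  have hQ₁T := hasDerivAt_transpose hQ₁
  set P : Matrix ν ν ℝ := (Matrix.of (H t))⁻¹ with hPdef
  -- term 1: `Q₁·P·Qᵀ`
  have hA1 := hasDerivAt_matMul (X := Q₁) (Y := fun u => Matrix.of.symm (Matrix.of (H u))⁻¹) hQ₁ hP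
  have hT1 := hasDerivAt_matMul (X := fun u => Matrix.of.symm (Matrix.of (Q₁ u) * Matrix.of (Matrix.of.symm (Matrix.of (H u))⁻¹)))
    (Y := fun u => Matrix.of.symm (Matrix.of (Q u))ᵀ) hA1 hQT
  -- term 2: `Q·P·Q₁ᵀ`
  have hA2 := hasDerivAt_matMul (X := Q) (Y := fun u => Matrix.of.symm (Matrix.of (H u))⁻¹) hQ' hP
  have hT2 := hasDerivAt_matMul (X := fun u => Matrix.of.symm (Matrix.of (Q u) * Matrix.of (Matrix.of.symm (Matrix.of (H u))⁻¹)))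
    (Y := fun u => Matrix.of.symm (Matrix.of (Q₁ u))ᵀ) hA2 hQ₁T
  -- term 3: `((Q·P)·H₁)·P·Qᵀ`
  have hB3 := hasDerivAt_matMul (X := fun u => Matrix.of.symm (Matrix.of (Q u) * Matrix.of (Matrix.of.symm (Matrix.of (H u))⁻¹)))
    (Y := H₁) hA2 hH₁
  have hC3 := hasDerivAt_matMul
    (X := fun u => Matrix.of.symm (Matrix.of (Matrix.of.symm (Matrix.of (Q u) * Matrix.of (Matrix.of.symm (Matrix.of (H u))⁻¹))) * Matrix.of (H₁ u)))
    (Y := fun u => Matrix.of.symm (Matrix.of (H u))⁻¹) hB3 hP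
  have hT3 := hasDerivAt_matMul
    (X := fun u => Matrix.of.symm (Matrix.of (Matrix.of.symm (Matrix.of (Matrix.of.symm (Matrix.of (Q u)
      * Matrix.of (Matrix.of.symm (Matrix.of (H u))⁻¹))) * Matrix.of (H₁ u))) * Matrix.of (Matrix.of.symm (Matrix.of (H u))⁻¹)))
    (Y := fun u => Matrix.of.symm (Matrix.of (Q u))ᵀ) hC3 hQT
  have hsum := (hT1.add hT2).sub hT3
  have heq : (fun u => Matrix.of.symm (Matrix.of (Q₁ u) * (Matrix.of (H u))⁻¹ * (Matrix.of (Q u))ᵀ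
        + Matrix.of (Q u) * (Matrix.of (H u))⁻¹ * (Matrix.of (Q₁ u))ᵀ
        - Matrix.of (Q u) * (Matrix.of (H u))⁻¹ * Matrix.of (H₁ u) * (Matrix.of (H u))⁻¹ * (Matrix.of (Q u))ᵀ))
      = ((fun u => Matrix.of.symm (Matrix.of (Matrix.of.symm (Matrix.of (Q₁ u) * Matrix.of (Matrix.of.symm (Matrix.of (H u))⁻¹)))
            * Matrix.of (Matrix.of.symm (Matrix.of (Q u))ᵀ)))
        + (fun u => Matrix.of.symm (Matrix.of (Matrix.of.symm (Matrix.of (Q u) * Matrix.of (Matrix.of.symm (Matrix.of (H u))⁻¹)))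
            * Matrix.of (Matrix.of.symm (Matrix.of (Q₁ u))ᵀ))))
        - (fun u => Matrix.of.symm (Matrix.of (Matrix.of.symm (Matrix.of (Matrix.of.symm (Matrix.of (Matrix.of.symm (Matrix.of (Q u)
            * Matrix.of (Matrix.of.symm (Matrix.of (H u))⁻¹))) * Matrix.of (H₁ u))) * Matrix.of (Matrix.of.symm (Matrix.of (H u))⁻¹)))
            * Matrix.of (Matrix.of.symm (Matrix.of (Q u))ᵀ))) := by
    funext u
    simp only [Pi.add_apply, Pi.sub_apply, Equiv.apply_symm_apply]
    rfl
  rw [heq]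
  refine hsum.congr_deriv ?_
  simp only [hPdef, Equiv.apply_symm_apply, Matrix.add_mul, Matrix.mul_neg, Matrix.neg_mul, Matrix.mul_assoc, two_smul]
  funext i j
  simp only [Pi.add_apply, Pi.sub_apply, Matrix.of_symm_apply, Matrix.add_apply, Matrix.sub_apply, Matrix.neg_apply]
  ring

/-! ## §4 The second variation of `log|det C|` is the loop catalogue -/

/-- [folklore] **JACOBI FOR THE INDUCED COARSE FORM**: near `t`, `(log|det Q·H⁻¹·Qᵀ|)′ = tr(C⁻¹·C₁)` with the displayed first jet, provided
`det H ≠ 0` and `det C ≠ 0` at the point. -/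
theorem hasDerivAt_logAbsDet_blockProp {H : ℝ → ν → ν → ℝ} {Q : ℝ → μ → ν → ℝ} {H₁ : Matrix ν ν ℝ} {Q₁ : Matrix μ ν ℝ} {t : ℝ}
    (hH : HasDerivAt H (Matrix.of.symm H₁) t) (hQ : HasDerivAt Q (Matrix.of.symm Q₁) t) (hdet : (Matrix.of (H t)).det ≠ 0)
    (hC : (blockProp (Matrix.of (H t)) (Matrix.of (Q t))).det ≠ 0) :
    HasDerivAt (fun u => Real.log |(blockProp (Matrix.of (H u)) (Matrix.of (Q u))).det|)
      (((blockProp (Matrix.of (H t)) (Matrix.of (Q t)))⁻¹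
        * (Q₁ * ((Matrix.of (H t))⁻¹ * (Matrix.of (Q t))ᵀ) + (Matrix.of (Q t) * (Matrix.of (H t))⁻¹) * Q₁ᵀ
            - (Matrix.of (Q t) * (Matrix.of (H t))⁻¹) * H₁ * ((Matrix.of (H t))⁻¹ * (Matrix.of (Q t))ᵀ))).trace) t := by
  have h := hasDerivAt_blockProp hH hQ hdet
  have hC' : (Matrix.of ((fun u => Matrix.of.symm (blockProp (Matrix.of (H u)) (Matrix.of (Q u)))) t)).det ≠ 0 := by
    simpa only [Equiv.apply_symm_apply] using hC
  exact (hasDerivAt_logAbsDet (A := fun u => Matrix.of.symm (blockProp (Matrix.of (H u)) (Matrix.of (Q u)))) h hC').congr_deriv rfl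

/-- [folklore] **THE SECOND VARIATION OF `log|det C|` AT `t` IS `secondVar C C₁ C₂`** with the displayed jets: if `H`, `Q` have derivative curves
`H₁(u)`, `Q₁(u)` NEAR `t`, these are differentiable at `t` with derivatives `H₂`, `Q₂`, `det H(u) ≠ 0` near `t` and `det C(t) ≠ 0`, then
`u ↦ tr(C(u)⁻¹·C₁(u))` (the first variation, by `hasDerivAt_logAbsDet_blockProp`) has derivative `secondVar C(t) C₁(t) C₂` at `t`. -/
theorem secondVariation_blockProp {H H₁ : ℝ → ν → ν → ℝ} {Q Q₁ : ℝ → μ → ν → ℝ} {H₂ : Matrix ν ν ℝ} {Q₂ : Matrix μ ν ℝ} {t : ℝ}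
    (hH : ∀ᶠ u in 𝓝 t, HasDerivAt H (H₁ u) u) (hQ : ∀ᶠ u in 𝓝 t, HasDerivAt Q (Q₁ u) u)
    (hH₁ : HasDerivAt H₁ (Matrix.of.symm H₂) t) (hQ₁ : HasDerivAt Q₁ (Matrix.of.symm Q₂) t)
    (hdet : ∀ᶠ u in 𝓝 t, (Matrix.of (H u)).det ≠ 0) (hC : (blockProp (Matrix.of (H t)) (Matrix.of (Q t))).det ≠ 0) :
    HasDerivAt (fun u => ((blockProp (Matrix.of (H u)) (Matrix.of (Q u)))⁻¹
        * (Matrix.of (Q₁ u) * (Matrix.of (H u))⁻¹ * (Matrix.of (Q u))ᵀ + Matrix.of (Q u) * (Matrix.of (H u))⁻¹ * (Matrix.of (Q₁ u))ᵀ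
            - Matrix.of (Q u) * (Matrix.of (H u))⁻¹ * Matrix.of (H₁ u) * (Matrix.of (H u))⁻¹ * (Matrix.of (Q u))ᵀ)).trace)
      (secondVar (blockProp (Matrix.of (H t)) (Matrix.of (Q t)))
        (Matrix.of (Q₁ t) * (Matrix.of (H t))⁻¹ * (Matrix.of (Q t))ᵀ + Matrix.of (Q t) * (Matrix.of (H t))⁻¹ * (Matrix.of (Q₁ t))ᵀ
            - Matrix.of (Q t) * (Matrix.of (H t))⁻¹ * Matrix.of (H₁ t) * (Matrix.of (H t))⁻¹ * (Matrix.of (Q t))ᵀ)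
        (Q₂ * ((Matrix.of (H t))⁻¹ * (Matrix.of (Q t))ᵀ) + (Matrix.of (Q t) * (Matrix.of (H t))⁻¹) * Q₂ᵀ
          - (2 : ℝ) • (Matrix.of (Q₁ t) * (Matrix.of (H t))⁻¹ * Matrix.of (H₁ t) * ((Matrix.of (H t))⁻¹ * (Matrix.of (Q t))ᵀ))
          - (2 : ℝ) • ((Matrix.of (Q t) * (Matrix.of (H t))⁻¹) * Matrix.of (H₁ t) * (Matrix.of (H t))⁻¹ * (Matrix.of (Q₁ t))ᵀ)
          + (2 : ℝ) • (Matrix.of (Q₁ t) * (Matrix.of (H t))⁻¹ * (Matrix.of (Q₁ t))ᵀ)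
          + (2 : ℝ) • ((Matrix.of (Q t) * (Matrix.of (H t))⁻¹) * Matrix.of (H₁ t) * (Matrix.of (H t))⁻¹ * Matrix.of (H₁ t)
              * ((Matrix.of (H t))⁻¹ * (Matrix.of (Q t))ᵀ))
          - (Matrix.of (Q t) * (Matrix.of (H t))⁻¹) * H₂ * ((Matrix.of (H t))⁻¹ * (Matrix.of (Q t))ᵀ))) t := by
  -- the `C`-curve and its first-jet curve in `LogDetSecondVariation`'s currency
  set C : ℝ → μ → μ → ℝ := fun u => Matrix.of.symm (blockProp (Matrix.of (H u)) (Matrix.of (Q u))) with hCdef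
  set C₁ : ℝ → μ → μ → ℝ := fun u => Matrix.of.symm (Matrix.of (Q₁ u) * (Matrix.of (H u))⁻¹ * (Matrix.of (Q u))ᵀ
      + Matrix.of (Q u) * (Matrix.of (H u))⁻¹ * (Matrix.of (Q₁ u))ᵀ
      - Matrix.of (Q u) * (Matrix.of (H u))⁻¹ * Matrix.of (H₁ u) * (Matrix.of (H u))⁻¹ * (Matrix.of (Q u))ᵀ) with hC₁def
  -- `C′ = C₁` at `t` (from `hasDerivAt_blockProp`, reassociated)
  have hCd : HasDerivAt C (C₁ t) t := by
    have hHt : HasDerivAt H (Matrix.of.symm (Matrix.of (H₁ t))) t := hH.self_of_nhds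
    have hQt : HasDerivAt Q (Matrix.of.symm (Matrix.of (Q₁ t))) t := hQ.self_of_nhds
    have h := hasDerivAt_blockProp hHt hQt hdet.self_of_nhds
    rw [hCdef]
    convert h using 2
    simp only [Matrix.mul_assoc]
  -- `C₁′ = C₂` at `t`
  have hC₁d := hasDerivAt_blockProp_jet₁ hH.self_of_nhds hQ.self_of_nhds hH₁ hQ₁ hdet.self_of_nhds
  have hCdet : (Matrix.of (C t)).det ≠ 0 := by simpa only [hCdef, Equiv.apply_symm_apply] using hC
  exact (hasDerivAt_trace_inv_mul (A := C) (A₁ := C₁) hCd hC₁d hCdet).congr_deriv rfl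

/-- [folklore] **ROW RHOA-2 AS THE OWNER STATES IT — `δ² log det (Q·P·Qᵀ)` ALONG A `C²` MATRIX PATH IS THE LOOP CATALOGUE**: under the hypotheses
of `secondVariation_blockProp` and SYMMETRY of `H(t)` and of `H₁(t)`, the derivative at `t` of the first variation `u ↦ tr(C(u)⁻¹·C₁(u))` equals
`2tr(Q̈𝓘) − 2tr(Q̇𝓘Q̇𝓘) + 2tr(GQ̇Γ₀Q̇ᵀ) − 4tr(Q̇Γ₀Ḣ𝓘) + 2tr(R^QḢPḢ) − tr(R^QḢR^QḢ) − tr(R^QḦ)` at `t`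
(`P = H(t)⁻¹`, `G = C(t)⁻¹`, `𝓘 = minMap`, `Γ₀ = constrProp`, `R^Q = 𝓘·Q·P`; `InducedPolarizationLoops.secondVar_blockProp_jets`). -/
theorem secondVariation_blockProp_eq_loops {H H₁ : ℝ → ν → ν → ℝ} {Q Q₁ : ℝ → μ → ν → ℝ} {H₂ : Matrix ν ν ℝ} {Q₂ : Matrix μ ν ℝ} {t : ℝ}
    (hH : ∀ᶠ u in 𝓝 t, HasDerivAt H (H₁ u) u) (hQ : ∀ᶠ u in 𝓝 t, HasDerivAt Q (Q₁ u) u)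
    (hH₁ : HasDerivAt H₁ (Matrix.of.symm H₂) t) (hQ₁ : HasDerivAt Q₁ (Matrix.of.symm Q₂) t)
    (hdet : ∀ᶠ u in 𝓝 t, (Matrix.of (H u)).det ≠ 0) (hC : (blockProp (Matrix.of (H t)) (Matrix.of (Q t))).det ≠ 0)
    (hsymm : (Matrix.of (H t))ᵀ = Matrix.of (H t)) (hsymm₁ : (Matrix.of (H₁ t))ᵀ = Matrix.of (H₁ t)) :
    HasDerivAt (fun u => ((blockProp (Matrix.of (H u)) (Matrix.of (Q u)))⁻¹
        * (Matrix.of (Q₁ u) * (Matrix.of (H u))⁻¹ * (Matrix.of (Q u))ᵀ + Matrix.of (Q u) * (Matrix.of (H u))⁻¹ * (Matrix.of (Q₁ u))ᵀ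
            - Matrix.of (Q u) * (Matrix.of (H u))⁻¹ * Matrix.of (H₁ u) * (Matrix.of (H u))⁻¹ * (Matrix.of (Q u))ᵀ)).trace)
      (2 * (Q₂ * minMap (Matrix.of (H t)) (Matrix.of (Q t))).trace
        - 2 * (Matrix.of (Q₁ t) * minMap (Matrix.of (H t)) (Matrix.of (Q t)) * (Matrix.of (Q₁ t) * minMap (Matrix.of (H t)) (Matrix.of (Q t)))).trace
        + 2 * ((blockProp (Matrix.of (H t)) (Matrix.of (Q t)))⁻¹ * Matrix.of (Q₁ t) * constrProp (Matrix.of (H t)) (Matrix.of (Q t))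
            * (Matrix.of (Q₁ t))ᵀ).trace
        - 4 * (Matrix.of (Q₁ t) * constrProp (Matrix.of (H t)) (Matrix.of (Q t)) * Matrix.of (H₁ t) * minMap (Matrix.of (H t)) (Matrix.of (Q t))).trace
        + 2 * (minMap (Matrix.of (H t)) (Matrix.of (Q t)) * Matrix.of (Q t) * (Matrix.of (H t))⁻¹ * Matrix.of (H₁ t) * (Matrix.of (H t))⁻¹
            * Matrix.of (H₁ t)).trace
        - (minMap (Matrix.of (H t)) (Matrix.of (Q t)) * Matrix.of (Q t) * (Matrix.of (H t))⁻¹ * Matrix.of (H₁ t)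
            * (minMap (Matrix.of (H t)) (Matrix.of (Q t)) * Matrix.of (Q t) * (Matrix.of (H t))⁻¹ * Matrix.of (H₁ t))).trace
        - (minMap (Matrix.of (H t)) (Matrix.of (Q t)) * Matrix.of (Q t) * (Matrix.of (H t))⁻¹ * H₂).trace) t := by
  have h := secondVariation_blockProp hH hQ hH₁ hQ₁ hdet hC
  rw [secondVar_blockProp_jets hsymm hsymm₁ H₂ (Matrix.of (Q t)) (Matrix.of (Q₁ t)) Q₂ _ _ (by simp only [Matrix.mul_assoc]) rfl] at h
  exact h

end Summit.QuantumFields.BalabanUV.Beta.FP.InducedPolarizationCurve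

end
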